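import Mathlib.Topology.MetricSpace.Closeds
import Mathlib.Topology.MetricSpace.Thickening
import Mathlib.Topology.Semicontinuity.Basic
import Literature.Analysis.Complex.ConformalRadius
import HarnessLib

/-!
# Lower semicontinuity of the conformal radius in the Hausdorff metric (proofs only)

Def-free companion of `ConformalRadius.lean` (the extremal conformal radius
`Literature.Analysis.Complex.conformalRadius K` of the component of `0` in `𝔻 ∖ K`, used by
Lawler–Schramm–Werner 2002 for the one-arm exponent of critical percolation, (2.1)–(2.2)).

* `IsUnivalentInto.comp_mul` — shrinking an admissible univalent map: if `φ : 𝔻 → 𝔻 ∖ K` is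
  admissible and `0 < s < 1`, then `z ↦ φ(sz)` is admissible for every `K'` disjoint from the
  compact set `φ(s Ū)`, with `|(φ(s·))'(0)| = s |φ'(0)|`.
* `lowerSemicontinuous_conformalRadius` — `K ↦ 𝔯(K)` is lower semicontinuous on the Hausdorff
  space `NonemptyCompacts ℂ`: if `K_n → K` then `liminf 𝔯(K_n) ≥ 𝔯(K)` (an admissible map for
  `K`, slightly shrunk, is admissible for all Hausdorff-close `K'`). This is the elementary half of
  Carathéodory kernel convergence; the conformal radius is NOT Hausdorff-continuous.
* `isClosed_setOf_conformalRadius_le` — consequently the events `{K | 𝔯(K) ≤ ρ}` of LSW (2.2)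
  (`h(2π, t) = P[𝔯 ≤ e^{-t}]`, see `Literature/Probability/Percolation/OneArmHittingPDE.lean`,
  `OneArmSubsequentialLimits.lean`) are closed, in particular Borel, subsets of the Hausdorff
  space.

## References

* G. F. Lawler, O. Schramm, W. Werner, *One-arm exponent for critical 2D percolation*, Electron.
  J. Probab. 7 (2002), no. 2, §2, (2.1)–(2.2) (p. 4) [LawlerSchrammWernerEJP2002].
* G. F. Lawler, *Conformally invariant processes in the plane*, AMS (2005), §3.2 [Lawler2008].
-/

noncomputable section

open Metric Set Filter Topology TopologicalSpace

namespace Literature.Analysis.Complex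

variable {K K' : Set ℂ} {φ : ℂ → ℂ}

/-- **Shrinking an admissible map.** If `φ` is admissible for `K` (univalent `𝔻 → 𝔻 ∖ K`,
`φ(0) = 0`) and `0 < s < 1`, then `z ↦ φ(s z)` is admissible for every set `K'` disjoint from
`φ(closedBall 0 s)`. [folklore] -/
theorem IsUnivalentInto.comp_mul (h : IsUnivalentInto K φ) {s : ℝ} (hs0 : 0 < s) (hs1 : s < 1)
    (hK' : Disjoint (φ '' closedBall (0 : ℂ) s) K') :
    IsUnivalentInto K' fun z => φ ((s : ℂ) * z) := by
  have hmaps : MapsTo (fun z : ℂ => (s : ℂ) * z) (ball 0 1) (closedBall (0 : ℂ) s) := by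
    intro z hz
    rw [mem_ball, dist_zero_right] at hz
    rw [mem_closedBall, dist_zero_right, norm_mul, Complex.norm_real, Real.norm_eq_abs,
      abs_of_pos hs0]
    nlinarith
  have hball : closedBall (0 : ℂ) s ⊆ ball 0 1 := closedBall_subset_ball hs1
  refine ⟨?_, ?_, by simp [h.map_zero], fun z hz => ⟨?_, ?_⟩⟩
  · exact h.differentiableOn.comp ((differentiable_id.const_mul (s : ℂ)).differentiableOn)
      fun z hz => hball (hmaps hz)
  · intro z₁ hz₁ z₂ hz₂ heq
    have := h.injOn (hball (hmaps hz₁)) (hball (hmaps hz₂)) heq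
    have hs : (s : ℂ) ≠ 0 := by exact_mod_cast hs0.ne'
    simpa [hs] using this
  · exact (h.mapsTo (hball (hmaps hz))).1
  · exact fun hzK' => (Set.disjoint_left.1 hK') ⟨(s : ℂ) * z, hmaps hz, rfl⟩ hzK'

/-- Derivative at `0` of the shrunk map: `|(φ(s·))'(0)| = s |φ'(0)|`. [folklore] -/
theorem IsUnivalentInto.norm_deriv_comp_mul (h : IsUnivalentInto K φ) {s : ℝ} (hs0 : 0 < s) :
    ‖deriv (fun z => φ ((s : ℂ) * z)) 0‖ = s * ‖deriv φ 0‖ := by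
  have hφ : HasDerivAt φ (deriv φ 0) ((s : ℂ) * 0) := by
    rw [mul_zero]
    exact (h.differentiableOn.differentiableAt (ball_mem_nhds (0 : ℂ) one_pos)).hasDerivAt
  have hlin : HasDerivAt (fun z : ℂ => (s : ℂ) * z) (s : ℂ) 0 := by
    simpa using (hasDerivAt_id (0 : ℂ)).const_mul (s : ℂ)
  have hcomp : HasDerivAt (fun z => φ ((s : ℂ) * z)) (deriv φ 0 * (s : ℂ)) 0 :=
    hφ.comp (0 : ℂ) hlin
  rw [hcomp.deriv, norm_mul, Complex.norm_real, Real.norm_eq_abs, abs_of_pos hs0, mul_comm]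

/-- **The conformal radius is lower semicontinuous in the Hausdorff metric**: for nonempty
compact `K_n → K` in Hausdorff distance, `liminf 𝔯(K_n) ≥ 𝔯(K)`. Given an admissible `φ` for
`K` with `|φ'(0)|` close to `𝔯(K)` and `s < 1` close to `1`, the compact set `φ(s Ū) ⊆ 𝔻 ∖ K`
is at positive distance from `K`, hence disjoint from every Hausdorff-close `K'`, and `φ(s·)` is
admissible for `K'` with `|(φ(s·))'(0)| = s|φ'(0)|`. [folklore] -/
theorem lowerSemicontinuous_conformalRadius :
    LowerSemicontinuous fun K : NonemptyCompacts ℂ => conformalRadius (K : Set ℂ) := by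
  intro K c hc
  rcases lt_or_ge c 0 with hc0 | hc0
  · exact Eventually.of_forall fun K' => hc0.trans_le (conformalRadius_nonneg _)
  obtain ⟨r, hr, hcr⟩ := exists_lt_of_lt_csSup (insert_nonempty 0 _) hc
  rcases hr with rfl | ⟨φ, hφ, rfl⟩
  · exact absurd hcr (not_lt.2 hc0)
  have hr0 : 0 < ‖deriv φ 0‖ := hc0.trans_lt hcr
  -- `s ∈ (0, 1)` with `c < s |φ'(0)|`
  obtain ⟨s, hs, hs1⟩ := exists_between (max_lt ((div_lt_one hr0).2 hcr) one_half_lt_one)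
  have hs0 : 0 < s := lt_of_lt_of_le one_half_pos ((le_max_right _ _).trans hs.le)
  have hcs : c < s * ‖deriv φ 0‖ := by
    have : c / ‖deriv φ 0‖ < s := (le_max_left _ _).trans_lt hs
    rwa [div_lt_iff₀ hr0] at this
  -- the compact set `φ(closedBall 0 s)` is disjoint from `K`
  have hball : closedBall (0 : ℂ) s ⊆ ball 0 1 := closedBall_subset_ball hs1
  have hC : IsCompact (φ '' closedBall (0 : ℂ) s) :=
    (isCompact_closedBall (0 : ℂ) s).image_of_continuousOn
      (hφ.differentiableOn.continuousOn.mono hball)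
  have hCK : Disjoint (φ '' closedBall (0 : ℂ) s) (K : Set ℂ) := by
    rw [Set.disjoint_left]
    rintro _ ⟨z, hz, rfl⟩ hzK
    exact (hφ.mapsTo (hball hz)).2 hzK
  obtain ⟨δ, hδ, hdisj⟩ := hCK.exists_thickenings hC K.isCompact.isClosed
  -- every `K'` within Hausdorff distance `δ` of `K` lies in the `δ`-thickening of `K`
  filter_upwards [Metric.ball_mem_nhds K hδ] with K' hK'
  rw [mem_ball, Metric.NonemptyCompacts.dist_eq] at hK'
  have hK'C : Disjoint (φ '' closedBall (0 : ℂ) s) (K' : Set ℂ) := by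
    rw [Set.disjoint_left]
    intro x hxC hxK'
    obtain ⟨y, hy, hxy⟩ := exists_dist_lt_of_hausdorffDist_lt hxK' hK'
      (hausdorffEDist_ne_top_of_nonempty_of_bounded K'.nonempty K.nonempty
        K'.isCompact.isBounded K.isCompact.isBounded)
    have hx1 : x ∈ thickening δ (φ '' closedBall (0 : ℂ) s) := self_subset_thickening hδ _ hxC
    have hx2 : x ∈ thickening δ (K : Set ℂ) := mem_thickening_iff.2 ⟨y, hy, hxy⟩
    exact Set.disjoint_left.1 hdisj hx1 hx2
  have hadm := hφ.comp_mul hs0 hs1 hK'C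
  calc c < s * ‖deriv φ 0‖ := hcs
    _ = ‖deriv (fun z => φ ((s : ℂ) * z)) 0‖ := (hφ.norm_deriv_comp_mul hs0).symm
    _ ≤ conformalRadius (K' : Set ℂ) := hadm.norm_deriv_le_conformalRadius

/-- **The events `{𝔯 ≤ ρ}` are closed** in the Hausdorff space of nonempty compact subsets of
`ℂ` (LSW 2002, (2.2): `h(θ, t) = P[𝔯(θ) ≤ e^{-t}]`), by lower semicontinuity.
[cite: LawlerSchrammWernerEJP2002, (2.2) (p. 4)] -/
theorem isClosed_setOf_conformalRadius_le (ρ : ℝ) :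
    IsClosed {K : NonemptyCompacts ℂ | conformalRadius (K : Set ℂ) ≤ ρ} :=
  lowerSemicontinuous_conformalRadius.isClosed_preimage ρ

/-- Dually, the events `{ρ < 𝔯}` are open in the Hausdorff space. [folklore] -/
theorem isOpen_setOf_lt_conformalRadius (ρ : ℝ) :
    IsOpen {K : NonemptyCompacts ℂ | ρ < conformalRadius (K : Set ℂ)} :=
  lowerSemicontinuous_conformalRadius.isOpen_preimage ρ

end Literature.Analysis.Complex
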